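import Summits.AtomisticToContinuum.HydrodynamicLimit.Theorems.RelayRaceLocalityRestartPrincipleStubFiniteSize
import Summits.AtomisticToContinuum.HydrodynamicLimit.Theorems.RelayRaceLocalityRestartPrincipleClosesInBand
import HarnessLib

/-!
# `RestartPrinciple` (stmt-AtomisticToContinuum-12503), line `Sketch`: the restart induction, landed

Route `RelayRaceLocality`, crux `RestartPrinciple = (S → G)` (`S` the short-time guarded hydrodynamic
limit from local-Gibbs time-`0` data, `G` the packing-guarded conjunct = body of the shared item
stmt-AtomisticToContinuum-9133 `GermanoSplitLES.HydroLimitInBand`, moot copy stmt-3093).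

This file lands the PROVED part of the line's skeleton (`Cruxes/RestartPrinciple/Lines/Sketch.lean`,
leads -0 / c1 / c2) as importable theorems, so that the skeleton's composition is one line and the crux
closes mechanically from either of two inputs:

* `guardedConjunct_of_restartableHL` — THE RESTART INDUCTION over the grid `k · τ₁(M(t)) / 2` along
  the given classical solution: the short-time limit in RESTARTABLE currency along the true law
  (`RestartableHL`: prefix `∃ η₀ ∀ profile ∃ σ₀ ∀ σ < σ₀ ∀ M ∃ τ₁`, restart from any `s₀ ∈ [0, T)` given
  the LLN on `[0, s₀]`, under packing `< η₀` and `C³`-size `≤ M` guards on `[0, t]`) implies `G`; the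
  guard level `M` on `[0, t]` is supplied by the landed `stub_finiteSize` (p96553);
* `restartPrinciple_of_restartableHL : RestartableHL → RestartPrinciple` (the antecedent `S` is not
  consumed — it cannot be: `Negative/RestartSchema.lean`, p99454);
* zero slack: with the disprover's converse `RestartPrincipleNegative.guardedConjunct_imp_stubRestartableHL`
  (p103746) one has `RestartableHL ↔ G` — the restartable currency carries exactly the burden of `G`;
* `restartPrinciple_of_guardedConjunct : G → RestartPrinciple` and
  `restartPrinciple_of_hydroLimitInBand : GermanoSplitLES.HydroLimitInBand → RestartPrinciple`
  (definitional: the consequent of the crux IS the body of stmt-9133).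

No new definitions; all statements are spelled out verbatim from the route file / the skeleton.
prover-line-stmt-AtomisticToContinuum-12503-c2-0 (lead c2), 2026-08-16.

Maintenance record (full-build repair, 2026-08-17; dependency drift, content unchanged). Route
`GermanoSplitLES` rev 5 (2026-08-16T23:18Z) DROPPED its copy of the shared item `HydroLimitInBand`
(stmt-9133), so `Theses.GermanoSplitLES` no longer declares
`Summit.AtomisticToContinuum.HydrodynamicLimit.Theses.GermanoSplitLES.HydroLimitInBand`, which the last
theorem names fully qualified in its signature. That exact name is now carried, as a verbatim RECORD of the
dropped copy (token-identical to the live shared decl `ImplosionDichotomy.HydroLimitInBand`), by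
`Theorems/RelayRaceLocalityRestartPrincipleClosesInBand.lean`; this file imports that module instead of
`Theses.GermanoSplitLES` (whose only use here was that decl), so every statement and proof below is
byte-for-byte unchanged and the name is declared once in the tree (no second copy here). Since the re-type
p126922 the same body is also `_root_.HydrodynamicLimit`; the glue against that decl is
`restartPrinciple_of_hydrodynamicLimit` (`…RestartPrincipleOfConjunct.lean`).
-/

noncomputable section

open Literature.MathematicalPhysics.KineticTheory Literature.Analysis.FluidPDE
open Literature.Analysis.FunctionSpaces MeasureTheory Filter Set
open Summit.AtomisticToContinuum.HydrodynamicLimit.Theses.RelayRaceLocality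

namespace Summit.AtomisticToContinuum.HydrodynamicLimit.Theorems.RestartPrinciple

/-- **Restart induction.** The short-time hydrodynamic limit in restartable currency along the true law
(`RestartableHL`, verbatim the statement of the skeleton's `restartableHL_of_stubs` / the disprover's
`stub_restartableHL`) implies the packing-guarded conjunct `G` (consequent of the crux; body of
stmt-AtomisticToContinuum-9133): fix `t < T`, take the `C³`-size bound `M` of the classical solution on
`[0, t]` (`stub_finiteSize`), the restart step `τ₁ = τ₁(M)`, and induct over the grid `n · τ₁ / 2`. -/
theorem guardedConjunct_of_restartableHL
    (hR : ∃ η₀ : ℝ, 0 < η₀ ∧ ∀ (a₀ θ₀ : T3 → ℝ) (u₀ : T3 → V3), Continuous a₀ → Continuous θ₀ →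
      Continuous u₀ → (∀ x, 0 < a₀ x) → (∀ x, 0 < θ₀ x) → ∃ σ₀ : ℝ, 0 < σ₀ ∧ ∀ σ : ℝ, 0 < σ →
      σ < σ₀ → ∀ M : ℝ, 0 < M → ∃ τ₁ : ℝ, 0 < τ₁ ∧ ∀ (T : ℝ) (ρ θ : ℝ → T3 → ℝ) (u : ℝ → T3 → V3),
      IsHardSphereEulerSolution σ T ρ u θ →
      ∀ Φ : (N : ℕ) → HardSphereFlow (Torus.geometry (Fin 3)) (hsDiameter σ N) (N + 1),
      ∀ s₀ ∈ Set.Ico 0 T,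
      (∀ s ∈ Set.Icc 0 s₀,
        TendstoHydroFieldsAt (fun N => localGibbsLaw σ a₀ u₀ θ₀ N (Φ N)) Φ ρ u θ s) →
      ∀ t ∈ Set.Ico s₀ (min T (s₀ + τ₁)),
      (∀ s ∈ Set.Icc 0 t, ∀ x, ρ s x * σ ^ 3 < η₀ ∧ ρ s x ≤ M ∧ θ s x ≤ M ∧ M⁻¹ ≤ θ s x ∧
        ‖u s x‖ ≤ M ∧ ∀ i j k : Fin 3, |Torus.partialDeriv i (ρ s) x| ≤ M ∧
        ‖Torus.partialDeriv i (u s) x‖ ≤ M ∧ |Torus.partialDeriv i (θ s) x| ≤ M ∧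
        |Torus.partialDeriv i (Torus.partialDeriv j (ρ s)) x| ≤ M ∧
        ‖Torus.partialDeriv i (Torus.partialDeriv j (u s)) x‖ ≤ M ∧
        |Torus.partialDeriv i (Torus.partialDeriv j (θ s)) x| ≤ M ∧
        |Torus.partialDeriv i (Torus.partialDeriv j (Torus.partialDeriv k (ρ s))) x| ≤ M ∧
        ‖Torus.partialDeriv i (Torus.partialDeriv j (Torus.partialDeriv k (u s))) x‖ ≤ M ∧
        |Torus.partialDeriv i (Torus.partialDeriv j (Torus.partialDeriv k (θ s))) x| ≤ M) →
      TendstoHydroFieldsAt (fun N => localGibbsLaw σ a₀ u₀ θ₀ N (Φ N)) Φ ρ u θ t) :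
    ∃ η₀ : ℝ, 0 < η₀ ∧ ∀ (a₀ θ₀ : T3 → ℝ) (u₀ : T3 → V3), Continuous a₀ → Continuous θ₀ →
      Continuous u₀ → (∀ x, 0 < a₀ x) → (∀ x, 0 < θ₀ x) → ∃ σ₀ : ℝ, 0 < σ₀ ∧ ∀ σ : ℝ, 0 < σ →
      σ < σ₀ → ∀ (T : ℝ) (ρ θ : ℝ → T3 → ℝ) (u : ℝ → T3 → V3), IsHardSphereEulerSolution σ T ρ u θ →
      (∀ t ∈ Set.Ico 0 T, ∀ x, ρ t x * σ ^ 3 < η₀) →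
      ∀ Φ : (N : ℕ) → HardSphereFlow (Torus.geometry (Fin 3)) (hsDiameter σ N) (N + 1),
      TendstoHydroFieldsAt (fun N => localGibbsLaw σ a₀ u₀ θ₀ N (Φ N)) Φ ρ u θ 0 →
      ∀ t ∈ Set.Ico 0 T, TendstoHydroFieldsAt (fun N => localGibbsLaw σ a₀ u₀ θ₀ N (Φ N)) Φ ρ u θ t := by
  obtain ⟨η₀, hη₀, hS⟩ := hR
  refine ⟨η₀, hη₀, fun a₀ θ₀ u₀ ha hθ hu ha0 hθ0 => ?_⟩
  obtain ⟨σ₀, hσ₀, hS⟩ := hS a₀ θ₀ u₀ ha hθ hu ha0 hθ0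
  refine ⟨σ₀, hσ₀, fun σ hσ hσσ₀ T ρ θ u hsol hpack Φ h0 t ht => ?_⟩
  -- the guard level on `[0, t]` and the restart step
  obtain ⟨M, hM, hsize⟩ := stub_finiteSize σ T ρ θ u hsol t ht.2
  obtain ⟨τ₁, hτ₁, hstep⟩ := hS σ hσ hσσ₀ M hM
  -- full guards on `[0, s]` for every `s ≤ t`
  have hguard : ∀ s, s ≤ t → ∀ s' ∈ Set.Icc 0 s, ∀ x, ρ s' x * σ ^ 3 < η₀ ∧ ρ s' x ≤ M ∧
      θ s' x ≤ M ∧ M⁻¹ ≤ θ s' x ∧ ‖u s' x‖ ≤ M ∧ ∀ i j k : Fin 3,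
      |Torus.partialDeriv i (ρ s') x| ≤ M ∧ ‖Torus.partialDeriv i (u s') x‖ ≤ M ∧
      |Torus.partialDeriv i (θ s') x| ≤ M ∧
      |Torus.partialDeriv i (Torus.partialDeriv j (ρ s')) x| ≤ M ∧
      ‖Torus.partialDeriv i (Torus.partialDeriv j (u s')) x‖ ≤ M ∧
      |Torus.partialDeriv i (Torus.partialDeriv j (θ s')) x| ≤ M ∧
      |Torus.partialDeriv i (Torus.partialDeriv j (Torus.partialDeriv k (ρ s'))) x| ≤ M ∧
      ‖Torus.partialDeriv i (Torus.partialDeriv j (Torus.partialDeriv k (u s'))) x‖ ≤ M ∧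
      |Torus.partialDeriv i (Torus.partialDeriv j (Torus.partialDeriv k (θ s'))) x| ≤ M := by
    intro s hs s' hs' x
    have hs't : s' ∈ Set.Icc 0 t := ⟨hs'.1, hs'.2.trans hs⟩
    exact ⟨hpack s' ⟨hs'.1, lt_of_le_of_lt hs't.2 ht.2⟩ x, hsize s' hs't x⟩
  -- restart induction over the grid `n · (τ₁ / 2)`
  have key : ∀ n : ℕ, ∀ s ∈ Set.Icc 0 t, s ≤ n * (τ₁ / 2) →
      TendstoHydroFieldsAt (fun N => localGibbsLaw σ a₀ u₀ θ₀ N (Φ N)) Φ ρ u θ s := by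
    intro n
    induction n with
    | zero =>
      intro s hs hsn
      have hs0 : s = 0 := le_antisymm (by simpa using hsn) hs.1
      rw [hs0]
      exact h0
    | succ n ih =>
      intro s hs hsn
      by_cases hcase : s ≤ n * (τ₁ / 2)
      · exact ih s hs hcase
      · push Not at hcase
        set s₀ : ℝ := n * (τ₁ / 2) with hs₀def
        have hs₀nn : 0 ≤ s₀ := by positivity
        have hs₀s : s₀ < s := hcase
        have hs₀T : s₀ ∈ Set.Ico 0 T := ⟨hs₀nn, (hs₀s.trans_le hs.2).trans ht.2⟩
        have hprev : ∀ s' ∈ Set.Icc 0 s₀,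
            TendstoHydroFieldsAt (fun N => localGibbsLaw σ a₀ u₀ θ₀ N (Φ N)) Φ ρ u θ s' :=
          fun s' hs' => ih s' ⟨hs'.1, hs'.2.trans (hs₀s.le.trans hs.2)⟩ hs'.2
        have hsI : s ∈ Set.Ico s₀ (min T (s₀ + τ₁)) := by
          refine ⟨hs₀s.le, lt_min (hs.2.trans_lt ht.2) ?_⟩
          have h1 : s ≤ s₀ + τ₁ / 2 := by
            have : ((n + 1 : ℕ) : ℝ) * (τ₁ / 2) = s₀ + τ₁ / 2 := by push_cast; ring
            linarith [hsn, this]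
          linarith
        exact hstep T ρ θ u hsol Φ s₀ hs₀T hprev s hsI (hguard s hs.2)
  -- reach `t` in finitely many steps
  obtain ⟨n, hn⟩ := exists_nat_ge (t / (τ₁ / 2))
  refine key n t ⟨ht.1, le_rfl⟩ ?_
  have hτ2 : 0 < τ₁ / 2 := half_pos hτ₁
  rwa [div_le_iff₀ hτ2] at hn

/-- **The crux from the restartable short-time limit.** `RestartableHL → RestartPrinciple`: the
consequent `G` is `guardedConjunct_of_restartableHL`; the antecedent `S` of the crux is not used (and
cannot be: its prefix `∀ M ∃ τ₁ … ∃ σ₀` and its time-`0` anchoring are not restartable,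
`RestartPrincipleNegative.prefixMfirst_schema_false` / `anchored_schema_false`). -/
theorem restartPrinciple_of_restartableHL :
    (∃ η₀ : ℝ, 0 < η₀ ∧ ∀ (a₀ θ₀ : T3 → ℝ) (u₀ : T3 → V3), Continuous a₀ → Continuous θ₀ →
      Continuous u₀ → (∀ x, 0 < a₀ x) → (∀ x, 0 < θ₀ x) → ∃ σ₀ : ℝ, 0 < σ₀ ∧ ∀ σ : ℝ, 0 < σ →
      σ < σ₀ → ∀ M : ℝ, 0 < M → ∃ τ₁ : ℝ, 0 < τ₁ ∧ ∀ (T : ℝ) (ρ θ : ℝ → T3 → ℝ) (u : ℝ → T3 → V3),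
      IsHardSphereEulerSolution σ T ρ u θ →
      ∀ Φ : (N : ℕ) → HardSphereFlow (Torus.geometry (Fin 3)) (hsDiameter σ N) (N + 1),
      ∀ s₀ ∈ Set.Ico 0 T,
      (∀ s ∈ Set.Icc 0 s₀,
        TendstoHydroFieldsAt (fun N => localGibbsLaw σ a₀ u₀ θ₀ N (Φ N)) Φ ρ u θ s) →
      ∀ t ∈ Set.Ico s₀ (min T (s₀ + τ₁)),
      (∀ s ∈ Set.Icc 0 t, ∀ x, ρ s x * σ ^ 3 < η₀ ∧ ρ s x ≤ M ∧ θ s x ≤ M ∧ M⁻¹ ≤ θ s x ∧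
        ‖u s x‖ ≤ M ∧ ∀ i j k : Fin 3, |Torus.partialDeriv i (ρ s) x| ≤ M ∧
        ‖Torus.partialDeriv i (u s) x‖ ≤ M ∧ |Torus.partialDeriv i (θ s) x| ≤ M ∧
        |Torus.partialDeriv i (Torus.partialDeriv j (ρ s)) x| ≤ M ∧
        ‖Torus.partialDeriv i (Torus.partialDeriv j (u s)) x‖ ≤ M ∧
        |Torus.partialDeriv i (Torus.partialDeriv j (θ s)) x| ≤ M ∧
        |Torus.partialDeriv i (Torus.partialDeriv j (Torus.partialDeriv k (ρ s))) x| ≤ M ∧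
        ‖Torus.partialDeriv i (Torus.partialDeriv j (Torus.partialDeriv k (u s))) x‖ ≤ M ∧
        |Torus.partialDeriv i (Torus.partialDeriv j (Torus.partialDeriv k (θ s))) x| ≤ M) →
      TendstoHydroFieldsAt (fun N => localGibbsLaw σ a₀ u₀ θ₀ N (Φ N)) Φ ρ u θ t) →
    RestartPrinciple :=
  fun hR _ => guardedConjunct_of_restartableHL hR

-- ZERO SLACK (recorded, not restated): the converse `G → RestartableHL` is the disprover's landed
-- `RestartPrincipleNegative.guardedConjunct_imp_stubRestartableHL` (p103746,
-- `Theorems/RestartPrinciple/Negative/StubRestartableHLOfGuardedConjunct.lean`), so together with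
-- `guardedConjunct_of_restartableHL` above: `RestartableHL ↔ G` — the restartable currency carries exactly
-- the burden of `G`; whatever proves the line's remaining bets proves `G` outright.

/-- The crux from its consequent: `G → RestartPrinciple` (the antecedent is discarded). -/
theorem restartPrinciple_of_guardedConjunct
    (hG : ∃ η₀ : ℝ, 0 < η₀ ∧ ∀ (a₀ θ₀ : T3 → ℝ) (u₀ : T3 → V3), Continuous a₀ → Continuous θ₀ →
      Continuous u₀ → (∀ x, 0 < a₀ x) → (∀ x, 0 < θ₀ x) → ∃ σ₀ : ℝ, 0 < σ₀ ∧ ∀ σ : ℝ, 0 < σ →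
      σ < σ₀ → ∀ (T : ℝ) (ρ θ : ℝ → T3 → ℝ) (u : ℝ → T3 → V3), IsHardSphereEulerSolution σ T ρ u θ →
      (∀ t ∈ Set.Ico 0 T, ∀ x, ρ t x * σ ^ 3 < η₀) →
      ∀ Φ : (N : ℕ) → HardSphereFlow (Torus.geometry (Fin 3)) (hsDiameter σ N) (N + 1),
      TendstoHydroFieldsAt (fun N => localGibbsLaw σ a₀ u₀ θ₀ N (Φ N)) Φ ρ u θ 0 →
      ∀ t ∈ Set.Ico 0 T, TendstoHydroFieldsAt (fun N => localGibbsLaw σ a₀ u₀ θ₀ N (Φ N)) Φ ρ u θ t) :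
    RestartPrinciple :=
  fun _ => hG

/-- **The crux from the shared item stmt-AtomisticToContinuum-9133.** The consequent of
`RestartPrinciple` is, definitionally, the packing-guarded conjunct `GermanoSplitLES.HydroLimitInBand`
(since route GermanoSplitLES rev 5 a verbatim record of the dropped route copy, declared in
`…RestartPrincipleClosesInBand.lean`; same body as the live `ImplosionDichotomy.HydroLimitInBand` and as
`_root_.HydrodynamicLimit`); hence that item closes this crux in one line (recommendation of leads -0 / c1 /
c2 to the planner). -/
theorem restartPrinciple_of_hydroLimitInBand
    (h : Summit.AtomisticToContinuum.HydrodynamicLimit.Theses.GermanoSplitLES.HydroLimitInBand) :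
    RestartPrinciple :=
  fun _ => h

end Summit.AtomisticToContinuum.HydrodynamicLimit.Theorems.RestartPrinciple

end
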